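import Mathlib
import Summits.ValiantsHypothesis.ValiantsHypothesis.Theses.ValuativeGCT
import Literature.Computability.Complexity.OccurrenceObstructionsIPProofs
import Summits.ValiantsHypothesis.ValiantsHypothesis.Theorems.ValuativeGCTValuativeFlipIsotypicSliceBound
import Summits.ValiantsHypothesis.ValiantsHypothesis.Theorems.ValuativeGCTValuativeFlipTwistedInheritance

/-!
# Isotypic slice bound, part 3: the tail criterion in inner-shape terms

Det side of crux `ValuativeGCT.ValuativeFlip` (stmt-ValiantsHypothesis-12624; wall-breaker axis
"det-orbit-closure multiplicity bounds for detCensus").  The siege's tail programme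
(`Cruxes/ValuativeFlip/SiegeStubs.lean`: `stub_tailCertificates` + `stub_evalRankLowerBound` +
`stub_twistedInheritance`) transports per-side CERTIFICATES on an inner shape `μ ⊢ nδ` to the padded
position `(n, n + j)` on the Kadish–Landsberg lift `μ♯ = rowLift μ j` (first row `μ₁ + jδ`, the other rows
those of `μ`).  Since the isotypic det census of part 2 does not see the first row, the det side at the
LIFTED shape is bounded in terms of the INNER shape alone:

* `isotypic_truncT_rowLift_finrank_le`, `isotypic_detOrbitMultiplicity_rowLift_le` — for `m = n + j ≥ 2`:
  `dim T_U(μ♯) , K_m((μ♯)*) ≤ (μ₂ + 1)^(m+1) · ∏_{i ≥ 3} (μ_i + 1)^(m²)`;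
* `flipBody_of_twistedCertificate` — a Δ_j-twisted nonsingular inner evaluation matrix of size `D`
  (the hypotheses of the landed `stub_twistedInheritance`, verbatim) with
  `D > (μ₂ + 1)^(m+1) · ∏_{i ≥ 3} (μ_i + 1)^(m²)` gives the crux's flip body at `(n, n + j)` (verbatim
  `let χ; let T` of `ValuativeGCT.ValuativeFlip`, witnesses `U = ⊥`, `r = 0`, `λ = μ♯`), and
  `detOrbitMultiplicity_rowLift_lt_of_twistedCertificate` the Mulmuley–Sohoni obstruction
  `K_m((μ♯)*) < mult_{(μ♯)*} ℂ[Δ_m(X₀₀^j per_n)]`.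

So the tail (`stub_tailFlip` = `TailFlip` = the crux) is reduced to an INNER computation with an explicit
target: at inner size `n`, for the paddings `j` of the window, a shape `μ ⊢ nδ` and a twisted certificate
of size exceeding `(μ₂+1)^(n+j+1) · ∏_{i≥3} (μ_i+1)^((n+j)²)`.  Pure composition of landed theorems.
-/

set_option linter.dupNamespace false

namespace Summit.ValiantsHypothesis.ValiantsHypothesis.Theorems.ValuativeFlip

open MvPolynomial
open scoped BigOperators Matrix
open Literature.NumberTheory.DiophantineGeometry
open Literature.Computability.AlgebraicComplexity
open Literature.Computability.Complexity

noncomputable section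

/-- The isotypic det census of a row-lift reads off the INNER shape: the product over the parts
from the second on is the same for `μ` and `μ♯ = rowLift μ j` (`getD_sortedParts_rowLift`). [folklore] -/
theorem isotypicBound_rowLift_eq (n j δ m : ℕ) (μ : Nat.Partition (n * δ)) :
    ((rowLift μ j).sortedParts.getD 1 0 + 1) ^ (m + 1) *
        ∏ i ∈ Finset.Ico 2 (m * m), ((rowLift μ j).sortedParts.getD i 0 + 1) ^ (m * m) =
      (μ.sortedParts.getD 1 0 + 1) ^ (m + 1) *
        ∏ i ∈ Finset.Ico 2 (m * m), (μ.sortedParts.getD i 0 + 1) ^ (m * m) := by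
  rw [getD_sortedParts_rowLift, if_neg (by norm_num)]
  congr 1
  refine Finset.prod_congr rfl fun i hi => ?_
  rw [Finset.mem_Ico] at hi
  rw [getD_sortedParts_rowLift, if_neg (by omega), add_zero]

/-- A row-lift of a shape with at most `n²` parts has at most `(n+j)²` parts (for `n + j ≥ 1`).
[folklore] -/
theorem iso_card_parts_rowLift_le_sq (n j δ : ℕ) (hm : 1 ≤ n + j) (μ : Nat.Partition (n * δ))
    (hμ : μ.parts.card ≤ n * n) : (rowLift μ j).parts.card ≤ (n + j) * (n + j) := by
  refine (card_parts_rowLift_le μ j).trans (max_le (hμ.trans (Nat.mul_le_mul (by omega) (by omega))) ?_)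
  nlinarith

/-- **Isotypic bound for the truncation at a lifted shape, in inner terms.**  For `m = n + j ≥ 2`,
every centre `U`, rank bound `r`, and inner shape `μ ⊢ nδ`, the crux's truncation at the
Kadish–Landsberg lift `μ♯ = rowLift μ j ⊢ mδ` satisfies
`dim T_U(μ♯) ≤ (μ₂ + 1)^(m+1) · ∏_{i ≥ 3} (μ_i + 1)^(m²)` — the padding `j` enters only through `m`.
[this crux's det census] -/
theorem isotypic_truncT_rowLift_finrank_le (n j : ℕ) (hm : 2 ≤ n + j) (U : Submodule ℂ (MatIdx (n + j) → ℂ))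
    (r δ : ℕ) (μ : Nat.Partition (n * δ)) :
    Module.finrank ℂ ↥(MvPolynomial.homogeneousSubmodule (MatIdx (n + j) × MatIdx (n + j)) ℂ ((n + j) * δ) ⊓
        ((MvPolynomial.vanishingIdeal ℂ {p : MatIdx (n + j) × MatIdx (n + j) → ℂ |
            ∀ j' : MatIdx (n + j), (fun i => p (j', i)) ∈ U}) ^ (δ * (n + j - r))).restrictScalars ℂ ⊓
        (⨅ (M : Matrix (MatIdx (n + j)) (MatIdx (n + j)) ℂ)
          (_ : linSubst (MatIdx (n + j)) ℂ M (detFormLex ℂ (n + j)) = detFormLex ℂ (n + j)),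
          LinearMap.ker ((MvPolynomial.aeval (R := ℂ) fun p : MatIdx (n + j) × MatIdx (n + j) =>
              ∑ l : MatIdx (n + j), M l p.2 • MvPolynomial.X (p.1, l)).toLinearMap -
            LinearMap.id (R := ℂ) (M := MvPolynomial (MatIdx (n + j) × MatIdx (n + j)) ℂ))) ⊓
        (⨅ (g : Matrix.GeneralLinearGroup (MatIdx (n + j)) ℂ) (_ : IsUpperTriangular g),
          LinearMap.ker ((MvPolynomial.aeval (R := ℂ) fun p : MatIdx (n + j) × MatIdx (n + j) =>
              ∑ l : MatIdx (n + j), ((g⁻¹ : Matrix.GeneralLinearGroup (MatIdx (n + j)) ℂ) :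
                Matrix (MatIdx (n + j)) (MatIdx (n + j)) ℂ) p.1 l • MvPolynomial.X (l, p.2)).toLinearMap -
            weightChar (partitionWeightLex (n + j) (rowLift μ j)) g •
              LinearMap.id (R := ℂ) (M := MvPolynomial (MatIdx (n + j) × MatIdx (n + j)) ℂ)))) ≤
      (μ.sortedParts.getD 1 0 + 1) ^ (n + j + 1) *
        ∏ i ∈ Finset.Ico 2 ((n + j) * (n + j)), (μ.sortedParts.getD i 0 + 1) ^ ((n + j) * (n + j)) := by
  rw [← isotypicBound_rowLift_eq n j δ (n + j) μ]
  exact isotypic_truncT_finrank_le (n + j) hm U r δ (rowLift μ j)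

/-- **Isotypic det-orbit-closure bound at a lifted shape, in inner terms.**  For `m = n + j ≥ 2` and
`μ ⊢ nδ` with at most `n²` parts,
`K_m((μ♯)*) = mult_{(μ♯)*} ℂ[Δ(det_m)] ≤ (μ₂ + 1)^(m+1) · ∏_{i ≥ 3} (μ_i + 1)^(m²)`.
This is the det-side number an inner certificate transported by `stub_twistedInheritance` has to beat.
[this crux's det census; BLMW 2011 §5.2] -/
theorem isotypic_detOrbitMultiplicity_rowLift_le (n j : ℕ) [NeZero (n + j)] (hm : 2 ≤ n + j) (δ : ℕ)
    (μ : Nat.Partition (n * δ)) (hμ : μ.parts.card ≤ n * n) :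
    orbitMultiplicity ℂ (detFormLex ℂ (n + j)) (n + j) (partitionWeightLex (n + j) (rowLift μ j)) ≤
      (μ.sortedParts.getD 1 0 + 1) ^ (n + j + 1) *
        ∏ i ∈ Finset.Ico 2 ((n + j) * (n + j)), (μ.sortedParts.getD i 0 + 1) ^ ((n + j) * (n + j)) := by
  rw [← isotypicBound_rowLift_eq n j δ (n + j) μ]
  exact isotypic_detOrbitMultiplicity_le (n + j) hm δ (rowLift μ j)
    (iso_card_parts_rowLift_le_sq n j δ (by omega) μ hμ)

/-- **The flip body from a twisted inner certificate** (tail criterion of the crux in inner terms).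
Let `m = n + j ≥ 2`, `μ ⊢ nδ` with at most `n²` parts, and suppose `D` inner highest-weight vectors
`F_i` of weight `μ*` have a nonsingular Δ_j-twisted evaluation matrix at points `A_l · per_n`
(the hypotheses of the landed `stub_twistedInheritance`, verbatim), with
`D > (μ₂ + 1)^(m+1) · ∏_{i ≥ 3} (μ_i + 1)^(m²)`.  Then the body of `ValuativeGCT.ValuativeFlip` holds at
the position `(n, m)` (verbatim `let χ; let T`), with the no-cut centre `U = ⊥`, `r = 0`, the degree `δ`
and the lifted shape `λ = μ♯`: `dim T_⊥(μ♯) ≤ isotypic census < D ≤ mult_{(μ♯)*} ℂ[Δ_m(X₀₀^j per_n)]`.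
[this crux; composition of `stub_twistedInheritance` and `isotypic_truncT_rowLift_finrank_le`] -/
theorem flipBody_of_twistedCertificate :
    ∀ (n j δ : ℕ) [NeZero n] [NeZero (n + j)], 2 ≤ n + j → ∀ (μ : Nat.Partition (n * δ)), μ.parts.card ≤ n * n →
      ∀ (D : ℕ) (F : Fin D → MvPolynomial (DegIdx (MatIdx n) n) ℂ),
        (∀ i, F i ∈ highestWeightSpace (coordRep (MatIdx n) ℂ n) (partitionWeightLex n μ)) →
        ∀ (A : Fin D → Matrix (MatIdx n) (MatIdx n) ℂ),
          (Matrix.of fun i l : Fin D => MvPolynomial.aeval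
              (fun e : DegIdx (MatIdx n) n =>
                (((e.1 (topMatIdx n) + j).descFactorial j : ℕ) : ℂ) *
                  MvPolynomial.coeff e.1 (linSubst (MatIdx n) ℂ (A l) (paddedPerFormLex ℂ n n)))
              (F i)).det ≠ 0 →
          (μ.sortedParts.getD 1 0 + 1) ^ (n + j + 1) *
              ∏ i ∈ Finset.Ico 2 ((n + j) * (n + j)), (μ.sortedParts.getD i 0 + 1) ^ ((n + j) * (n + j)) < D →
          ∃ (U : Submodule ℂ (MatIdx (n + j) → ℂ)) (r δ' : ℕ) (lam : Nat.Partition ((n + j) * δ')),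
            (∀ u ∈ U, (Matrix.of fun a b : Fin (n + j) => u (toLex (a, b))).rank ≤ r) ∧
            lam.parts.card ≤ (n + j) * (n + j) ∧
            (let χ : Weight (MatIdx (n + j)) := (Weight.dualOfPartition ((n + j) * (n + j)) lam).toMatIdx;
             let T : Submodule ℂ (MvPolynomial (MatIdx (n + j) × MatIdx (n + j)) ℂ) :=
               MvPolynomial.homogeneousSubmodule (MatIdx (n + j) × MatIdx (n + j)) ℂ ((n + j) * δ') ⊓
                 ((MvPolynomial.vanishingIdeal ℂ {p : MatIdx (n + j) × MatIdx (n + j) → ℂ |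
                     ∀ j' : MatIdx (n + j), (fun i => p (j', i)) ∈ U}) ^ (δ' * (n + j - r))).restrictScalars ℂ ⊓
                 (⨅ (M : Matrix (MatIdx (n + j)) (MatIdx (n + j)) ℂ)
                   (_ : linSubst (MatIdx (n + j)) ℂ M (detFormLex ℂ (n + j)) = detFormLex ℂ (n + j)),
                   LinearMap.ker ((MvPolynomial.aeval (R := ℂ) fun p : MatIdx (n + j) × MatIdx (n + j) =>
                       ∑ l : MatIdx (n + j), M l p.2 • MvPolynomial.X (p.1, l)).toLinearMap -
                     LinearMap.id (R := ℂ) (M := MvPolynomial (MatIdx (n + j) × MatIdx (n + j)) ℂ))) ⊓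
                 (⨅ (g : Matrix.GeneralLinearGroup (MatIdx (n + j)) ℂ) (_ : IsUpperTriangular g),
                   LinearMap.ker ((MvPolynomial.aeval (R := ℂ) fun p : MatIdx (n + j) × MatIdx (n + j) =>
                       ∑ l : MatIdx (n + j), ((g⁻¹ : Matrix.GeneralLinearGroup (MatIdx (n + j)) ℂ) :
                         Matrix (MatIdx (n + j)) (MatIdx (n + j)) ℂ) p.1 l • MvPolynomial.X (l, p.2)).toLinearMap -
                     weightChar χ g • LinearMap.id (R := ℂ) (M := MvPolynomial (MatIdx (n + j) × MatIdx (n + j)) ℂ)));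
             Module.finrank ℂ ↥T < orbitMultiplicity ℂ (paddedPerFormLex ℂ n (n + j)) (n + j) χ) := by
  intro n j δ _ _ hm μ hμ D F hF A hdet hD
  have hP := stub_twistedInheritance n j δ μ hμ D F hF A hdet
  refine ⟨⊥, 0, δ, rowLift μ j, ?_, iso_card_parts_rowLift_le_sq n j δ (by omega) μ hμ, ?_⟩
  · intro u hu
    rw [Submodule.mem_bot] at hu
    subst hu
    have h0 : (Matrix.of fun a b : Fin (n + j) => (0 : MatIdx (n + j) → ℂ) (toLex (a, b))) = 0 := by
      ext a b
      simp
    rw [h0, Matrix.rank_zero]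
  · intro χ T
    exact lt_of_le_of_lt (isotypic_truncT_rowLift_finrank_le n j hm ⊥ 0 δ μ) (lt_of_lt_of_le hD hP)

/-- **Mulmuley–Sohoni obstruction from a twisted inner certificate.**  Under the same hypotheses,
`K_m((μ♯)*) < mult_{(μ♯)*} ℂ[Δ_m(X₀₀^j per_n)]` at `m = n + j`. [this crux; Mulmuley–Sohoni 2001 §4] -/
theorem detOrbitMultiplicity_rowLift_lt_of_twistedCertificate (n j δ : ℕ) [NeZero n] [NeZero (n + j)]
    (hm : 2 ≤ n + j) (μ : Nat.Partition (n * δ)) (hμ : μ.parts.card ≤ n * n)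
    (D : ℕ) (F : Fin D → MvPolynomial (DegIdx (MatIdx n) n) ℂ)
    (hF : ∀ i, F i ∈ highestWeightSpace (coordRep (MatIdx n) ℂ n) (partitionWeightLex n μ))
    (A : Fin D → Matrix (MatIdx n) (MatIdx n) ℂ)
    (hdet : (Matrix.of fun i l : Fin D => MvPolynomial.aeval
        (fun e : DegIdx (MatIdx n) n =>
          (((e.1 (topMatIdx n) + j).descFactorial j : ℕ) : ℂ) *
            MvPolynomial.coeff e.1 (linSubst (MatIdx n) ℂ (A l) (paddedPerFormLex ℂ n n)))
        (F i)).det ≠ 0)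
    (hD : (μ.sortedParts.getD 1 0 + 1) ^ (n + j + 1) *
        ∏ i ∈ Finset.Ico 2 ((n + j) * (n + j)), (μ.sortedParts.getD i 0 + 1) ^ ((n + j) * (n + j)) < D) :
    orbitMultiplicity ℂ (detFormLex ℂ (n + j)) (n + j) (partitionWeightLex (n + j) (rowLift μ j)) <
      orbitMultiplicity ℂ (paddedPerFormLex ℂ n (n + j)) (n + j) (partitionWeightLex (n + j) (rowLift μ j)) :=
  lt_of_le_of_lt (isotypic_detOrbitMultiplicity_rowLift_le n j hm δ μ hμ)
    (lt_of_lt_of_le hD (stub_twistedInheritance n j δ μ hμ D F hF A hdet))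

end

end Summit.ValiantsHypothesis.ValiantsHypothesis.Theorems.ValuativeFlip
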